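import Literature.AlgebraicGeometry.Motives.Comparison
import HarnessLib

/-!
# Comparison of Weil cohomology theories: invariance of homological triviality (proofs)

This file discharges the named fact
`Literature.AlgebraicGeometry.Motives.WeilComparison.isHomologicallyTrivial_iff` of
`Literature.AlgebraicGeometry.Motives.Comparison`: if two Weil cohomology theories `W₁`
(coefficients `K₁`) and `W₂` (coefficients `K₂`) are compared over a common overfield `L`
(structure `WeilComparison`, in particular `iso (1 ⊗ cl₁(Z)) = 1 ⊗ cl₂(Z)` for prime cycles `Z`),
then for `X` smooth projective and `c` a cycle of pure codimension `p`,
`cl₁(c) = 0 ↔ cl₂(c) = 0`.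

Source: P. Deligne (notes by J. Milne), *Hodge cycles on abelian varieties*, article I of
Deligne–Milne–Ogus–Shih, *Hodge cycles, motives, and Shimura varieties*, LNM 900 (1982), §1
"Review of cohomology": the comparison isomorphisms `H_B ⊗ ℂ ≅ H_dR ⊗ ℂ`, `H_B ⊗ 𝔸^f ≅ H_ét` are
compatible with the cycle maps ("the three maps `c₁` are compatible with the comparison
isomorphisms and it follows formally that the maps `cl` are also compatible"). The equivalence
`cl₁(c) = 0 ↔ cl₂(c) = 0` is the formal consequence: `x ↦ 1 ⊗ x : H → L ⊗_K H` is injective over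
a field and the comparison map is bijective on smooth projective `X`.

## Main results

* `WeilComparison.iso_one_tmul_cycleMap` : `iso (1 ⊗ cl₁(c)) = 1 ⊗ cl₂(c)` for `c` of pure
  codimension `p` on a smooth projective `X` (additive extension of the axiom `iso_cycleClass`).
* `WeilComparison.isHomologicallyTrivial_iff_holds` : the discharge.

## Design notes

* No finiteness of the support of `c` (no compactness of `X`) is needed: an *injective* additive
  map commutes with `finsum` including its junk value `0` on infinite supports
  (`AddMonoidHom.map_finsum_of_injective`), and both `x ↦ 1 ⊗ x` and `iso` are injective.
* Injectivity of `x ↦ 1 ⊗ x` is Mathlib's `Module.Flat.tensorProduct_mk_injective`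
  (`L` is a faithful, `V` a flat `K`-module over the field `K`).

## References

* P. Deligne, J. Milne, A. Ogus, K.-y. Shih, *Hodge cycles, motives, and Shimura varieties*,
  LNM 900 (1982), article I (Deligne, notes by Milne), §1.
-/

universe u v w w'

open CategoryTheory AlgebraicGeometry
open scoped TensorProduct

namespace Literature.AlgebraicGeometry.Motives.WeilComparison

section PreWeil

variable {k : Type u} [Field k] {K₁ : Type v} {K₂ : Type w} [Field K₁] [Field K₂]
  {W₁ : PreWeilCohomology k K₁} {W₂ : PreWeilCohomology k K₂} {L : Type w'} [Field L]
  [Algebra K₁ L] [Algebra K₂ L] {n : ℕ} {X : SchemeOver k}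

/-- Over a field `K`, `x ↦ 1 ⊗ x : V → L ⊗_K V` is injective for any field extension `L/K`
(a special case of Mathlib's `Module.Flat.tensorProduct_mk_injective`). [folklore] -/
theorem one_tmul_injective (K : Type*) (L : Type*) [Field K] [Field L] [Algebra K L]
    (V : Type*) [AddCommGroup V] [Module K V] :
    Function.Injective fun x : V ↦ (1 : L) ⊗ₜ[K] x :=
  Module.Flat.tensorProduct_mk_injective K V L

/-- `1 ⊗ (∑ᶠ z, f z) = ∑ᶠ z, 1 ⊗ f z` in `L ⊗_K V`, with no finiteness assumption (both sides
take the junk value `0` simultaneously, `x ↦ 1 ⊗ x` being injective). [folklore] -/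
theorem one_tmul_finsum (K : Type*) (L : Type*) [Field K] [Field L] [Algebra K L]
    {V : Type*} [AddCommGroup V] [Module K V] {α : Type*} (f : α → V) :
    (1 : L) ⊗ₜ[K] (∑ᶠ z, f z) = ∑ᶠ z, (1 : L) ⊗ₜ[K] f z :=
  (TensorProduct.mk K L V 1).toAddMonoidHom.map_finsum_of_injective
    (Module.Flat.tensorProduct_mk_injective K V L) f

/-- **Transport of cycle maps under a comparison.** For `X` smooth projective and `c` a cycle of
pure codimension `p`, `iso (1 ⊗ cl₁(c)) = 1 ⊗ cl₂(c)`: the comparison isomorphism is compatible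
with the cycle maps (Deligne–Milne 1982, I §1, "the maps `cl` are also compatible [with the
comparison isomorphisms]"; here obtained from the axiom `iso_cycleClass` on prime cycles by
additivity, `iso` being injective on smooth projective `X`). [cite: DeligneMilne1982, I §1] -/
theorem iso_one_tmul_cycleMap (C : WeilComparison W₁ W₂ L) (hX : IsSmoothProjective n X)
    (p : ℕ) {c : AlgebraicCycle X.left ℤ} (hc : c ∈ cyclesOfCodim X.left p) :
    C.iso X (2 * p) ((1 : L) ⊗ₜ[K₁] W₁.cycleMap X p c) = (1 : L) ⊗ₜ[K₂] W₂.cycleMap X p c := by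
  have hι : ∀ g : X.left → L ⊗[K₁] W₁.obj X (2 * p),
      C.iso X (2 * p) (∑ᶠ z, g z) = ∑ᶠ z, C.iso X (2 * p) (g z) := fun g ↦
    (C.iso X (2 * p)).toAddMonoidHom.map_finsum_of_injective (C.bijective_iso hX (2 * p)).1 g
  unfold PreWeilCohomology.cycleMap
  rw [one_tmul_finsum K₁ L, one_tmul_finsum K₂ L, hι]
  refine finsum_congr fun z ↦ ?_
  by_cases hz : c z = 0
  · simp [hz]
  · rw [TensorProduct.tmul_smul, TensorProduct.tmul_smul, map_zsmul,
      C.iso_cycleClass hX p z (hc z hz)]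

end PreWeil

section Weil

variable {k : Type u} [Field k] {K₁ : Type v} {K₂ : Type w} [Field K₁] [Field K₂]
  [CharZero K₁] [CharZero K₂] {W₁ : WeilCohomology k K₁} {W₂ : WeilCohomology k K₂}
  {L : Type w'} [Field L] [Algebra K₁ L] [Algebra K₂ L] {n : ℕ} {X : SchemeOver k}

/-- **Comparison invariance of homological triviality** (discharge of the named fact
`isHomologicallyTrivial_iff`): for `X` smooth projective and `c` of pure codimension `p`,
`cl₁(c) = 0 ↔ cl₂(c) = 0`, because `iso (1 ⊗ cl₁(c)) = 1 ⊗ cl₂(c)` (`iso_one_tmul_cycleMap`),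
`iso` is bijective on smooth projective `X`, and `x ↦ 1 ⊗ x` is injective over a field
(Deligne–Milne 1982, I §1: the cycle maps are compatible with the comparison isomorphisms).
[cite: DeligneMilne1982, I §1] -/
theorem isHomologicallyTrivial_iff_holds :
    isHomologicallyTrivial_iff (W₁ := W₁) (W₂ := W₂) (L := L) (n := n) (X := X) := by
  intro C hX p c hc
  have key := C.iso_one_tmul_cycleMap hX p hc
  have h₁ := one_tmul_injective K₁ L (W₁.obj X (2 * p))
  have h₂ := one_tmul_injective K₂ L (W₂.obj X (2 * p))
  simp only [WeilCohomology.IsHomologicallyTrivial]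
  constructor
  · intro h
    rw [h, TensorProduct.tmul_zero, map_zero] at key
    exact h₂ (by simpa using key.symm)
  · intro h
    rw [h, TensorProduct.tmul_zero, ← map_zero (C.iso X (2 * p))] at key
    exact h₁ (by simpa using (C.bijective_iso hX (2 * p)).1 key)

end Weil

end Literature.AlgebraicGeometry.Motives.WeilComparison
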